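import Literature.MathematicalPhysics.QuantumFieldTheory.Balaban1983to89.B3Ineq210MixedRegularTorus
import Literature.MathematicalPhysics.QuantumFieldTheory.Balaban1983to89.B3Ineq210RegularRegion
import Literature.MathematicalPhysics.QuantumFieldTheory.Balaban1983to89.B1Prop23RegularRegionSmall

/-!
# Bałaban, *(Higgs)₂,₃ quantum fields in a finite volume III. Renormalization* [B3] — (2.10) p. 426, THE CLAUSE *"for each
differentiation, there is an additional factor (L^jη)^{−1}"* WITH ONE COVARIANT DIFFERENTIATION IN EACH VARIABLE (the kernels
`(D^η_{B̃,μ}G^η_{(j)}D^{η*}_{B̃,ν})(Ω, B̃; x, x′)` of the scale pieces (2.6)), ON A REGION `Ω ⊆ T_η` THAT IS A UNION OF BIG BLOCKS (the full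
torus `Ω = T_η` included, EVERY `L ≥ 2`), AT A REGULAR NON-CONSTANT BACKGROUND `B̃ = A`, AT INTERIOR POINTS `x, x′` — PROVED for the region
pieces `G^η_{(j)}(Ω, A)` of r14's `B3Ineq210RegularRegion` (`pieceR`), uniformly in the volume

statement-level skeleton of published theorems with citation tags; proofs where landed; nothing here is a claim about the Yang–Mills mass gap

T. Bałaban, Commun. Math. Phys. **88** (1983) 411–445 [cite: Balaban1983Higgs3]; inputs from part I, Commun. Math. Phys. **85** (1982)
603–636 [cite: Balaban1982Higgs1] as landed in the tree.  PDF held: `paper:balaban1983-higgs-2-3-quantum-fields-finite-volume` (journal page =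
PDF page + 410), p. 426 [PDF 16] (`p0016.txt`), p. 424 [PDF 14], p. 432 [PDF 22]; part I p. 610 [PDF 8] (Proposition 2.1 and its `R₀`-clause).

CITATION HEADER (lean-in-tree rule).  Cell `lit-balaban` (HOME `run/shared/lean/pub/lit-balaban/`), Phase-2 proof seat **p33** gen 58 (unit
`lit-balaban-p33`); SKELETON row **B3.Eq2.10** (fold owner r15; decl of record `B3Sect2StatementsPart2.ScaledKernels.Ineq210`, whose two
displayed members — value and ONE derivative — are proved on regions by r14's `B3Ineq210RegularRegion.ineq210_regularRegion(_small)`; the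
twice-differentiated member is the clause of the same sentence used by §3 of [B3], by (3.1) and by the `δG` bound (2.5)).  This file is the
REGION TWIN of p40's `B3Ineq210MixedRegularTorus` (p341241: the same clause on the torus `Ω = T_η` of the `Shape` sub-family, `L` odd) over
r14's region pieces (p340643/p341267/v1.2): USED BY NAME, never restated — r14's `sandwichR`/`pieceR`/`levelSet`/`Interior` and region
engine (`norm_covDeriv_G_avgQkAdj_cb_le_R`, `mat_QG_eq_R`, `G_avgQkAdj_cb_eq_zero`, `mat_condCov232_levelSet`, `towerR`, `reg223R_of_small`),
p40's dipole algebra (`dip`, `sum_inner_dip`, `fieldCoord_dip_dotProduct`, `dip_support_dist`, `onb`, the constant `cstMix`), p35's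
Proposition I.2.1 (2.25) derivative clause at a regular `A` on big-block regions `B1Ineq225DerivRegularRegion.norm_covDeriv_propagatorK_region_reg_decay_sum`,
p35's one-parameter region form of (I.2.34) `B1Prop23RegularRegionSmall.prop23_regular_region_small`, the torus engine of r14's
`B3Ineq210RegularTorus` (`sum3_le`, `exp_blockIter_le`, `norm_covDeriv_apply_le_sum_coord`), the symmetry `B1Eq230FluctCovPos.siteInner_propagatorK_comm`
(stated for every `Ω`), the typer's `HiggsLattice`.

## What is printed (p. 426 [PDF 16], verbatim)

*"For the propagators G^η_{(j)} we apply the inequality |G^η_{(j)}(Ω, B̃; x, x′)| ≤ O(1)(L^jη)^{−d+2}e^{−δ₁(L^jη)^{−1}|x−x′|}, (2.10) and if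
the propagator is differentiated, then for each differentiation, there is an additional factor (L^jη)^{−1} on the right side. … They all
are obtained by rescaling from the η-lattice to the L^{−j}-lattice and application of Propositions I.2.1 and I.2.3."*  Two covariant
differentiations — `D^η_{B̃,μ}` in `x` from the left, the adjoint `D^{η*}_{B̃,ν}` in `x′` from the right — give the degree `−d`.  Part I p. 610,
Proposition 2.1: on a region `Ω` that is a union of big blocks the inequalities hold *"for x, x′ ∈ Ω and satisfying the condition
dist({x,x′},Ωᶜ) ≥ R₀"*.

## What this file proves (`ineq210_mixed_regularRegion`), and how

`ε^{−d}Σ_i‖(D^ε_{A,μ}G^η_{(j)}(Ω,A)D^{ε*}_{A,ν})(x, x′)e_i‖ ≤ C(L^jη)^{−d}e^{−δ₁(L^jη)^{−1}|x−x′|}` for every piece `j`, all INTERIOR bonds `⟨x,μ⟩`,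
`⟨x′,ν⟩` of a big-block union `Ω ⊆ T_ε` (`Interior k K₀ Ω x`, `Interior k K₀ Ω x′`: r14's lattice ball of radius `2r_S + 2L^kK₀(d+1) + 1` around
the point lies in `Ω` — the tree's form of print's `R₀`-clause), at a `δ_A`-regular non-constant background on `Ω` with the SINGLE smallness
`L^k·δ_A·|e| ≤ t(K₀)` — the hypotheses and constants-shape of r14's `ineq210_regularRegion_small` (every charge, every `L ≥ 2`, `K₀ ∣ M`,
`K₀ ≥ K₀,min`, at least three cubes a side, `L^kε ≤ 1`, `m² > 0`).  The right derivative is realised by p40's DIPOLE SOURCE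
`dip ⟨x′,ν⟩ w = δ_{x′+εe_ν}·U(A_{⟨x′,ν⟩})^*w − δ_{x′}·w = ε·D^{ε*}_A(δ_{⟨x′,ν⟩}w)`, so that `(D^ε_AG^η_{(j)}(Ω,A)(dip_c w))(b) =
ε·(D^ε_AG^η_{(j)}(Ω,A)D^{ε*}_A)(b,c)w` (`mixedTermR`).  Route = the print's / p40's: in each term `a_j²(L^jε)^{−4}G^ε_j(Ω,A)Q_j^*C^{(j)}(Ω,A)Q_jG^ε_j(Ω,A)`
of (I.2.43) the two derivatives fall on the two OUTER factors `G^ε_j(Ω, A)`: on the left by Proposition I.2.1 (2.25) (derivative member, at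
the interior bond `b`) directly, on the right by the same clause at the interior bond `c` after the adjointness `(Q_jG^ε_j(Ω))^* = G^ε_j(Ω)Q_j^*`
for the products (I.1.5) (`abs_coord_QG_dip_le_R`: the coordinates of `Q_jG^ε_j(Ω)(dip_c w)` ARE `L^{−jd}ε⟨w, D^ε_A(G^ε_j(Ω)Q_j^*e_t)(c)⟩`, and they
VANISH for block points `y_t ∉ Ω^{(j)}` — sources outside `Ω` do not reach `Ω`, `coord_QG_dip_eq_zero_R`); the middle factor by (I.2.34) on
`Ω^{(j)} × Ω^{(j)}`; the three-kernel convolution on `T^{(j)}` (`sum3_le`); the scaling `ε^{−d}·ε^{−1}·a_j²(L^jε)^{−4}(L^jε)^{1+2+1}L^{−jd}·ε =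
a_j²(L^jε)^{−d}`; the piece `G^η_{(0)} = G^ε_1(Ω,A)` is (2.25) at level `1` with the dipole source.  §0 the adjoint identities of the region kernels
(the symmetry `⟨w, G^ε_k(Ω)(x,x′)v⟩ = ⟨G^ε_k(Ω)(x′,x)w, v⟩` and `⟨w, (D^ε_AG^ε_k(Ω)δ_{x′}v)(b)⟩ = ε^{−1}⟨(G^ε_k(Ω) dip_b w)(x′), v⟩`, for the (2.5)/(3.1)
assembly on regions); §1 the engine on a region; §2 the pieces; §3 the theorem; §4 its `Ω = T_ε` case (every `L ≥ 2`, all `x, x′`), stated for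
p40's torus kernel `mixedTerm` through the dictionary `pieceR_univ`/`mixedTermR_univ` (the region pieces of the full torus ARE the torus pieces).
The hypotheses are exactly those of r14's `ineq210_regularRegion_small`; they are inhabited by PROPER regions with interior points at every
admissible cube size (r14's `regularRegion_hypotheses_nonvacuous`, at `A = 0`, `δ_A = 0`, where `L^k·0·|e| ≤ t` for every `t > 0`).

## Honest scope

As r14's region member: interior points only (nothing is claimed closer than the margin to `Ωᶜ`); `m² > 0`; `Ω` a union of `L^kK₀`-cells
(`IsBigBlockUnion k K₀ Ω`) in a volume with `K₀ ∣ M` and at least three cubes a side; constants depend on `K₀` and are chosen after the charge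
data (quantifier shape of the cited (I.2.25) input); `|·|` of an `N × N` block = the column sum over an orthonormal basis `e_i` of the
Euclidean norms.  No `def … : Prop`, no new named fact (`mixedTermR` is a concrete `def`; `dip`, `cstMix` are p40's); axioms standard.
Value = kernel certificate of a located by-reference step of B3 at a regular background on regions (the two-variable input of the
region forms of (2.5)/(3.1)), NOT summit progress.
-/

noncomputable section

open scoped BigOperators InnerProductSpace Matrix

namespace Literature.MathematicalPhysics.QuantumFieldTheory.Balaban1983to89.B3Ineq210MixedRegularRegion

open HiggsLattice (ChargeData ScalarField siteInner covDeriv)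
open HiggsCovariance (propagatorK avgQkLin avgQkAdj E)
open HiggsAveraging (blockIter)
open HiggsFluctMeasure (coeff221)
open B1Eq221Coordinates (fieldCoord fieldCoord_apply siteCoord_apply sum_inner_eq_dotProduct)
open B1Eq230FluctCov (mat Ix cb fluctCovA cb_repr mat_mulVec)
open B1Eq230FluctCovPos (siteInner_propagatorK_comm)
open B1Ineq234Concrete (profile profile_nonneg' nCol fieldCoord_cb)
open B1Ineq234LevelZero (tdist_comm tdist_triangle_real tdist_shift_le_one)
open B1TorusCubeCover (half)
open B1TorusCubeLocality26 (rS)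
open B1TorusRegionRop (chi)
open B1TorusRegionHSizes (IsBigBlockUnion isBigBlockUnion_univ)
open B2Eq337ScalarIntegration (Regions)
open B2Eq328ConcretePieces (pieceF)
open B3Ineq210RegularTorus (norm_avgQkAdj_cb_le blockIter_eq_of_avgQkAdj_cb_ne_zero blockDist_le_tdist sum3_le exp_blockIter_le
  norm_apply_le_sum_coord norm_covDeriv_apply_le_sum_coord abs_mat_le_norm norm_cb_le mesh_eq_pow_mul card_Ix eq_of_cb_ne_zero
  aSeq_sq_le covDeriv_smul'' covDeriv_zero'' mesh_mono)
open B3Ineq210RegularRegion (levelSet sandwichR pieceR pieceR_zero pieceR_of_pos pieceR_of_le Interior G_avgQkAdj_cb_eq_zero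
  norm_covDeriv_G_avgQkAdj_cb_le_R mat_QG_eq_R blockUnion_of_isBigBlockUnion isBigBlockUnion_of_le reg223R_of_small half_mono
  propagatorK_apply_eq_chi towerR pieceF_towerR levelSet_blockUnion mat_condCov232_levelSet interior_univ)
open B3Ineq210MixedRegularTorus (onb norm_onb dip norm_dip_le dip_eq_zero_of_ne sum_inner_dip fieldCoord_dip_dotProduct siteInner_dip
  norm_covDeriv_dip_le_sum dip_support_dist cstMix cstMix_pos le_cstMix_zero le_cstMix_pos abs_fieldCoord_apply_le
  siteInner_single_right)

variable {P : HiggsLattice.Params} {N : ℕ}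

/-! ## §0 Adjoint identities of the region kernels (for the two-variable assemblies on regions) -/

section AlgebraR

variable (C : ChargeData N) (Ω : Finset (HiggsLattice.Site P 0)) (A : HiggsLattice.VecField P 0) (msq a : ℝ)

/-- **Symmetry of the kernel of `G^ε_k(Ω, A)`**: `⟨w, (G^ε_k(Ω)δ_{x′}v)(x)⟩ = ⟨(G^ε_k(Ω)δ_xw)(x′), v⟩` — the `N × N` blocks satisfy
`G^ε_k(Ω;x,x′)^* = G^ε_k(Ω;x′,x)` (the region operator is symmetric for (I.1.5), `B1Eq230FluctCovPos.siteInner_propagatorK_comm`; p40's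
`inner_propagatorK_single_comm` is the case `Ω = T_ε`). [cite: Balaban1982Higgs1, (2.20) p.610] -/
theorem inner_propagatorK_single_comm_R (k : ℕ) (x x' : HiggsLattice.Site P 0) (v w : E N) :
    ⟪w, propagatorK C Ω A msq a k (Pi.single x' v) x⟫_ℝ
      = ⟪propagatorK C Ω A msq a k (Pi.single x w) x', v⟫_ℝ := by
  have h := siteInner_propagatorK_comm C Ω A msq a k (Pi.single x w) (Pi.single x' v)
  rw [HiggsFluctMeasurePos.siteInner_comm (Pi.single x w : ScalarField P 0 N), siteInner_single_right,
    HiggsFluctMeasurePos.siteInner_comm (Pi.single x' v : ScalarField P 0 N), siteInner_single_right, real_inner_comm] at h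
  have hm : (0 : ℝ) < P.mesh 0 ^ P.d := pow_pos (P.mesh_pos 0) _
  exact mul_left_cancel₀ hm.ne' h

/-- **The adjoint identity of the row-differentiated region block**: `⟨w, (D^ε_AG^ε_k(Ω)δ_{x′}v)(b)⟩ = ε^{−1}⟨(G^ε_k(Ω) dip_b w)(x′), v⟩` — the
COLUMN SLICE of the row-differentiated kernel, as a field of `x′`, is `ε^{−1}G^ε_k(Ω)(dip_b w)` (p40's dipole identity + symmetry).
[cite: Balaban1982Higgs1, (1.7) p.605, (2.20) p.610] -/
theorem inner_covDeriv_propagatorK_single_R (k : ℕ) (b : HiggsLattice.PBond P 0) (x' : HiggsLattice.Site P 0) (v w : E N) :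
    ⟪w, covDeriv C A (propagatorK C Ω A msq a k (Pi.single x' v)) b⟫_ℝ
      = (P.mesh 0)⁻¹ * ⟪propagatorK C Ω A msq a k (dip C A b w) x', v⟫_ℝ := by
  have hε : P.mesh 0 ≠ 0 := (P.mesh_pos 0).ne'
  have hm : (0 : ℝ) < P.mesh 0 ^ P.d := pow_pos (P.mesh_pos 0) _
  have h1 := siteInner_dip (C := C) (A := A) b w (propagatorK C Ω A msq a k (Pi.single x' v))
  rw [siteInner_propagatorK_comm C Ω A msq a k, HiggsFluctMeasurePos.siteInner_comm, siteInner_single_right] at h1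
  have h2 := mul_left_cancel₀ hm.ne' h1
  rw [h2, ← mul_assoc, inv_mul_cancel₀ hε, one_mul]

end AlgebraR

/-! ## §1 The engine on a region: the covariant derivative of one sandwich `G^ε_l(Ω)Q_l^*C^{(l)}(Ω)Q_lG^ε_l(Ω)` on a dipole source, at
interior bonds; inputs = the (I.2.25) derivative clause at «good» bonds (used on BOTH outer factors) and (I.2.34) on `Ω^{(l)} × Ω^{(l)}`;
sources in blocks outside `Ω` do not reach `Ω` -/

section EngineR

variable (C : ChargeData N) (Ω : Finset (HiggsLattice.Site P 0)) (A : HiggsLattice.VecField P 0) (msq a : ℝ) {l : ℕ}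

/-- **The third kernel on a dipole source, on a region, by adjointness**: the coordinates of `Q_lG^ε_l(Ω)(dip_c w)` are
`(Q_lG^ε_l(Ω) dip_c w)_t = L^{−ld}·ε·⟨w, (D^ε_A G^ε_l(Ω)Q_l^*e_t)(c)⟩`, in absolute value `≤ L^{−ld}·ε·‖w‖·‖(D^ε_AG^ε_l(Ω)Q_l^*e_t)(c)‖`
(`(Q_lG^ε_l(Ω))^* = G^ε_l(Ω)Q_l^*` for the products (I.1.5), r14's `mat_QG_eq_R`, and p40's dipole identity).
[cite: Balaban1982Higgs1, (1.5) p.604, (2.20) p.610] -/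
theorem abs_coord_QG_dip_le_R (c : HiggsLattice.PBond P 0) (w : E N) (t : HiggsLattice.Site P l × Ix N) :
    |fieldCoord (E N) (HiggsLattice.Site P l)
        (avgQkLin C A l (propagatorK C Ω A msq a l (dip C A c w))) t|
      ≤ (((P.L : ℝ) ^ l) ^ P.d)⁻¹ * (P.mesh 0 *
          (‖w‖ * ‖covDeriv C A (propagatorK C Ω A msq a l (avgQkAdj C A l (cb P N l t))) c‖)) := by
  set X := avgQkLin C A l ∘ₗ propagatorK C Ω A msq a l with hX
  set Xs := propagatorK C Ω A msq a l ∘ₗ avgQkAdj C A l with hXs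
  have hL : (0 : ℝ) ≤ (((P.L : ℝ) ^ l) ^ P.d)⁻¹ := inv_nonneg.mpr (pow_nonneg (pow_nonneg (Nat.cast_nonneg _) l) _)
  -- the coordinate as a matrix entry sum, then adjointness entry by entry
  have h1 : fieldCoord (E N) (HiggsLattice.Site P l) (avgQkLin C A l (propagatorK C Ω A msq a l (dip C A c w))) t
      = ∑ q : HiggsLattice.Site P 0 × Ix N, mat X t q * fieldCoord (E N) (HiggsLattice.Site P 0) (dip C A c w) q := by
    have : avgQkLin C A l (propagatorK C Ω A msq a l (dip C A c w)) = X (dip C A c w) := rfl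
    rw [this, ← mat_mulVec]; rfl
  have h2 : ∑ q : HiggsLattice.Site P 0 × Ix N, mat X t q * fieldCoord (E N) (HiggsLattice.Site P 0) (dip C A c w) q
      = (((P.L : ℝ) ^ l) ^ P.d)⁻¹ *
        (fieldCoord (E N) (HiggsLattice.Site P 0) (dip C A c w) ⬝ᵥ fieldCoord (E N) (HiggsLattice.Site P 0) (Xs (cb P N l t))) := by
    rw [dotProduct, Finset.mul_sum]
    refine Finset.sum_congr rfl fun q _ => ?_
    rw [hX, mat_QG_eq_R, ← hXs, B2Eq246ScalarStep.mat_apply]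
    ring
  rw [h1, h2, fieldCoord_dip_dotProduct, abs_mul, abs_of_nonneg hL]
  refine mul_le_mul_of_nonneg_left ?_ hL
  rw [abs_mul, abs_of_nonneg (P.mesh_pos 0).le]
  refine mul_le_mul_of_nonneg_left ?_ (P.mesh_pos 0).le
  rw [hXs, LinearMap.comp_apply]
  exact (abs_real_inner_le_norm _ _)

/-- **A source in a block OUTSIDE `Ω` does not reach the dipole bond**: `(D^ε_AG^ε_l(Ω)Q_l^*e_t)(c) = 0` for `y_t ∉ Ω^{(l)}` when both ends
of `c` lie in `Ω` (`Ω` a union of `l`-fold blocks; r14's `G_avgQkAdj_cb_eq_zero` at `c₋` and `c₊`). [cite: Balaban1982Higgs1, (2.20) p.610] -/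
theorem covDeriv_G_avgQkAdj_cb_eq_zero_R (hmsq : 0 < msq) (hak : 0 ≤ B1.aSeq a P.L l)
    (hΩ : ∀ x x' : HiggsLattice.Site P 0, blockIter l x = blockIter l x' → (x ∈ Ω ↔ x' ∈ Ω))
    (t : HiggsLattice.Site P l × Ix N) (ht : t.1 ∉ levelSet l Ω) {c : HiggsLattice.PBond P 0} (hc₁ : c.src ∈ Ω) (hc₂ : c.tgt ∈ Ω) :
    covDeriv C A (propagatorK C Ω A msq a l (avgQkAdj C A l (cb P N l t))) c = 0 := by
  rw [B1Cor23RegularRegion.covDeriv_eq, G_avgQkAdj_cb_eq_zero C Ω A msq a hmsq hak hΩ t ht hc₁,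
    G_avgQkAdj_cb_eq_zero C Ω A msq a hmsq hak hΩ t ht hc₂]
  simp

/-- **The third kernel on a dipole VANISHES for block points outside `Ω^{(l)}`** when both ends of the dipole bond lie in `Ω`.
[cite: Balaban1982Higgs1, (2.20) p.610] -/
theorem coord_QG_dip_eq_zero_R (hmsq : 0 < msq) (hak : 0 ≤ B1.aSeq a P.L l)
    (hΩ : ∀ x x' : HiggsLattice.Site P 0, blockIter l x = blockIter l x' → (x ∈ Ω ↔ x' ∈ Ω))
    (t : HiggsLattice.Site P l × Ix N) (ht : t.1 ∉ levelSet l Ω) {c : HiggsLattice.PBond P 0} (hc₁ : c.src ∈ Ω) (hc₂ : c.tgt ∈ Ω)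
    (w : E N) :
    fieldCoord (E N) (HiggsLattice.Site P l) (avgQkLin C A l (propagatorK C Ω A msq a l (dip C A c w))) t = 0 := by
  have h := abs_coord_QG_dip_le_R C Ω A msq a c w t
  rw [covDeriv_G_avgQkAdj_cb_eq_zero_R C Ω A msq a hmsq hak hΩ t ht hc₁ hc₂, norm_zero, mul_zero, mul_zero, mul_zero] at h
  exact abs_eq_zero.mp (le_antisymm h (abs_nonneg _))

/-- **The middle sum on a region, dipole source**: for `y_s ∈ Ω^{(l)}` and a dipole bond `c` with a good source point,
`Σ_t |C^{(l)}(Ω)(s,t)|·|(Q_lG^ε_l(Ω) dip_c w)_t| ≤ Σ_t c_Ce^{−δ|y_s−y_t|}·L^{−ld}ε‖w‖c_De^{δ}e^{−δ|(c₋)_l − y_t|}√N` — the entries with `y_t ∉ Ω^{(l)}`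
vanish (`coord_QG_dip_eq_zero_R`), the others are bounded by (I.2.34) on `Ω^{(l)}` and the (I.2.25) derivative clause at `c`.
[cite: Balaban1982Higgs1, Prop. 2.1 (2.25) p.610, Prop. 2.3 (2.34) p.611] -/
theorem sum_C_coordQGdip_le_R (hl : l ≤ P.K) (hmsq : 0 < msq) (hak : 0 ≤ B1.aSeq a P.L l)
    (hΩ : ∀ x x' : HiggsLattice.Site P 0, blockIter l x = blockIter l x' → (x ∈ Ω ↔ x' ∈ Ω))
    {good : HiggsLattice.Site P 0 → Prop} (hgood : ∀ x, good x → x ∈ Ω)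
    (hgood' : ∀ (x : HiggsLattice.Site P 0) (μ : Fin P.d), good x → x.shift μ ∈ Ω)
    {cD cC δ : ℝ} (hcD : 0 ≤ cD) (hcC : 0 ≤ cC) (hδ : 0 ≤ δ)
    (hDG : ∀ (g : ScalarField P 0 N) (M D : ℝ), (∀ x, ‖g x‖ ≤ M) → 0 ≤ D →
      ∀ b : HiggsLattice.PBond P 0, good b.src → (∀ z, g z ≠ 0 → D ≤ (HiggsLattice.Site.tdist b.src z : ℝ)) →
        ‖covDeriv C A (propagatorK C Ω A msq a l g) b‖ ≤ cD * Real.exp (-(δ * (D / (P.L : ℝ) ^ l))) * M)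
    (hC : ∀ s t : HiggsLattice.Site P l × Ix N, s.1 ∈ levelSet l Ω → t.1 ∈ levelSet l Ω →
      |mat (fluctCovA C Ω A msq a l) s t| ≤ cC * Real.exp (-(δ * (HiggsLattice.Site.tdist s.1 t.1 : ℝ))))
    {s : HiggsLattice.Site P l × Ix N} (hs : s.1 ∈ levelSet l Ω) {c : HiggsLattice.PBond P 0} (hc : good c.src) (w : E N) :
    ∑ t : HiggsLattice.Site P l × Ix N, |mat (fluctCovA C Ω A msq a l) s t| *
        |fieldCoord (E N) (HiggsLattice.Site P l) (avgQkLin C A l (propagatorK C Ω A msq a l (dip C A c w))) t|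
      ≤ ∑ t : HiggsLattice.Site P l × Ix N, cC * Real.exp (-(δ * (HiggsLattice.Site.tdist s.1 t.1 : ℝ))) *
          ((((P.L : ℝ) ^ l) ^ P.d)⁻¹ * (P.mesh 0 * (‖w‖ *
            (cD * Real.exp δ * Real.exp (-(δ * (HiggsLattice.Site.tdist (blockIter l c.src) t.1 : ℝ))) * Real.sqrt N)))) := by
  refine Finset.sum_le_sum fun t _ => ?_
  by_cases ht : t.1 ∈ levelSet l Ω
  · refine mul_le_mul (hC s t hs ht) ((abs_coord_QG_dip_le_R C Ω A msq a c w t).trans ?_) (abs_nonneg _) (by positivity)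
    refine mul_le_mul_of_nonneg_left (mul_le_mul_of_nonneg_left (mul_le_mul_of_nonneg_left ?_ (norm_nonneg _))
      (P.mesh_pos 0).le) (inv_nonneg.mpr (by positivity))
    exact norm_covDeriv_G_avgQkAdj_cb_le_R C Ω A msq a hl hcD hδ hDG t hc
  · rw [coord_QG_dip_eq_zero_R C Ω A msq a hmsq hak hΩ t ht (hgood _ hc) (hgood' _ _ hc) w, abs_zero, mul_zero]
    have hm0 : 0 ≤ P.mesh 0 := (P.mesh_pos 0).le
    positivity

/-- **THE SANDWICH ON A DIPOLE, DIFFERENTIATED, ON A REGION** — at a bond `b` and a dipole bond `c` with good (interior) source points, from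
the (I.2.25) derivative clause (both outer factors) and the (I.2.34) kernel bound on `Ω^{(l)} × Ω^{(l)}` with a common rate `δ > 0`:
`‖(D^ε_A G^ε_l(Ω)Q_l^*C^{(l)}(Ω)Q_lG^ε_l(Ω) dip_c w)(b)‖ ≤ (c_De^{δ}√N)²·c_C·L^{−ld}·K(δ/2)²·e^{δ/2}·ε‖w‖·e^{−(δ/2)|b₋ − c₋|/L^l}` (the same bound as
p40's torus engine). [cite: Balaban1982Higgs1, (2.43) p.612, Prop. 2.1 (2.25) p.610, Prop. 2.3 (2.34) p.611] [cite: Balaban1983Higgs3, (2.10) p.426] -/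
theorem norm_covDeriv_sandwichR_dip_le (hl : l ≤ P.K) (hmsq : 0 < msq) (hak : 0 ≤ B1.aSeq a P.L l)
    (hΩ : ∀ x x' : HiggsLattice.Site P 0, blockIter l x = blockIter l x' → (x ∈ Ω ↔ x' ∈ Ω))
    {good : HiggsLattice.Site P 0 → Prop} (hgood : ∀ x, good x → x ∈ Ω)
    (hgood' : ∀ (x : HiggsLattice.Site P 0) (μ : Fin P.d), good x → x.shift μ ∈ Ω)
    {cD cC δ : ℝ} (hcD : 0 ≤ cD) (hcC : 0 ≤ cC) (hδ : 0 < δ)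
    (hDG : ∀ (g : ScalarField P 0 N) (M D : ℝ), (∀ x, ‖g x‖ ≤ M) → 0 ≤ D →
      ∀ b : HiggsLattice.PBond P 0, good b.src → (∀ z, g z ≠ 0 → D ≤ (HiggsLattice.Site.tdist b.src z : ℝ)) →
        ‖covDeriv C A (propagatorK C Ω A msq a l g) b‖ ≤ cD * Real.exp (-(δ * (D / (P.L : ℝ) ^ l))) * M)
    (hC : ∀ s t : HiggsLattice.Site P l × Ix N, s.1 ∈ levelSet l Ω → t.1 ∈ levelSet l Ω →
      |mat (fluctCovA C Ω A msq a l) s t| ≤ cC * Real.exp (-(δ * (HiggsLattice.Site.tdist s.1 t.1 : ℝ))))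
    {c : HiggsLattice.PBond P 0} (hc : good c.src) (w : E N) {b : HiggsLattice.PBond P 0} (hb : good b.src) :
    ‖covDeriv C A (sandwichR C Ω A msq a l (dip C A c w)) b‖
      ≤ (cD * Real.exp δ * Real.sqrt N) ^ 2 * cC * (((P.L : ℝ) ^ l) ^ P.d)⁻¹ * profile P N (δ / 2) ^ 2 * Real.exp (δ / 2) *
          (P.mesh 0 * ‖w‖) * Real.exp (-(δ / 2 * ((HiggsLattice.Site.tdist b.src c.src : ℝ) / (P.L : ℝ) ^ l))) := by
  have h0 : sandwichR C Ω A msq a l (dip C A c w) = (propagatorK C Ω A msq a l ∘ₗ avgQkAdj C A l)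
      (fluctCovA C Ω A msq a l (avgQkLin C A l (propagatorK C Ω A msq a l (dip C A c w)))) := by
    simp only [sandwichR, LinearMap.comp_apply]
  rw [h0]
  refine (norm_covDeriv_apply_le_sum_coord C A _ _ b).trans ?_
  have hK : 0 ≤ profile P N (δ / 2) := profile_nonneg' _ (by linarith)
  have hm0 : 0 < P.mesh 0 := P.mesh_pos 0
  have hεw : 0 ≤ P.mesh 0 * ‖w‖ := mul_nonneg hm0.le (norm_nonneg _)
  -- a colour index to start the convolution (`N = 0`: the coordinate sum is empty)
  rcases isEmpty_or_nonempty (Ix N) with hN | ⟨⟨i₀⟩⟩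
  · rw [Finset.univ_eq_empty, Finset.sum_empty]
    exact mul_nonneg (mul_nonneg (mul_nonneg (mul_nonneg (mul_nonneg (mul_nonneg (sq_nonneg _) hcC)
      (inv_nonneg.mpr (by positivity))) (sq_nonneg _)) (Real.exp_pos _).le) hεw) (Real.exp_pos _).le
  calc ∑ s : HiggsLattice.Site P l × Ix N, |fieldCoord (E N) (HiggsLattice.Site P l)
            (fluctCovA C Ω A msq a l (avgQkLin C A l (propagatorK C Ω A msq a l (dip C A c w)))) s| *
          ‖covDeriv C A ((propagatorK C Ω A msq a l ∘ₗ avgQkAdj C A l) (cb P N l s)) b‖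
      ≤ ∑ s : HiggsLattice.Site P l × Ix N,
          (∑ t : HiggsLattice.Site P l × Ix N, cC * Real.exp (-(δ * (HiggsLattice.Site.tdist s.1 t.1 : ℝ))) *
            ((((P.L : ℝ) ^ l) ^ P.d)⁻¹ * (P.mesh 0 * (‖w‖ *
              (cD * Real.exp δ * Real.exp (-(δ * (HiggsLattice.Site.tdist (blockIter l c.src) t.1 : ℝ))) * Real.sqrt N))))) *
          (cD * Real.exp δ * Real.exp (-(δ * (HiggsLattice.Site.tdist (blockIter l b.src) s.1 : ℝ))) * Real.sqrt N) := by
        refine Finset.sum_le_sum fun s _ => ?_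
        by_cases hs : s.1 ∈ levelSet l Ω
        · have h1 : |fieldCoord (E N) (HiggsLattice.Site P l)
              (fluctCovA C Ω A msq a l (avgQkLin C A l (propagatorK C Ω A msq a l (dip C A c w)))) s|
              ≤ ∑ t : HiggsLattice.Site P l × Ix N, cC * Real.exp (-(δ * (HiggsLattice.Site.tdist s.1 t.1 : ℝ))) *
                ((((P.L : ℝ) ^ l) ^ P.d)⁻¹ * (P.mesh 0 * (‖w‖ *
                  (cD * Real.exp δ * Real.exp (-(δ * (HiggsLattice.Site.tdist (blockIter l c.src) t.1 : ℝ))) * Real.sqrt N)))) :=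
            (abs_fieldCoord_apply_le (fluctCovA C Ω A msq a l) _ s).trans
              (sum_C_coordQGdip_le_R C Ω A msq a hl hmsq hak hΩ hgood hgood' hcD hcC hδ.le hDG hC hs hc w)
          have h2 : ‖covDeriv C A ((propagatorK C Ω A msq a l ∘ₗ avgQkAdj C A l) (cb P N l s)) b‖
              ≤ cD * Real.exp δ * Real.exp (-(δ * (HiggsLattice.Site.tdist (blockIter l b.src) s.1 : ℝ))) * Real.sqrt N := by
            rw [LinearMap.comp_apply]
            exact norm_covDeriv_G_avgQkAdj_cb_le_R C Ω A msq a hl hcD hδ.le hDG s hb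
          exact mul_le_mul h1 h2 (norm_nonneg _) (Finset.sum_nonneg fun t _ => by positivity)
        · have hz : ‖covDeriv C A ((propagatorK C Ω A msq a l ∘ₗ avgQkAdj C A l) (cb P N l s)) b‖ = 0 := by
            rw [LinearMap.comp_apply, covDeriv_G_avgQkAdj_cb_eq_zero_R C Ω A msq a hmsq hak hΩ s hs (hgood _ hb) (hgood' _ _ hb),
              norm_zero]
          rw [hz, mul_zero]
          exact mul_nonneg (Finset.sum_nonneg fun t _ => by positivity) (by positivity)
    _ = (cD * Real.exp δ * Real.sqrt N) ^ 2 * cC * (((P.L : ℝ) ^ l) ^ P.d)⁻¹ * (P.mesh 0 * ‖w‖) *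
          ∑ s : HiggsLattice.Site P l × Ix N, ∑ t : HiggsLattice.Site P l × Ix N,
            Real.exp (-(δ * (HiggsLattice.Site.tdist (blockIter l b.src) s.1 : ℝ))) *
              Real.exp (-(δ * (HiggsLattice.Site.tdist s.1 t.1 : ℝ))) *
              Real.exp (-(δ * (HiggsLattice.Site.tdist (blockIter l c.src) t.1 : ℝ))) := by
        rw [Finset.mul_sum]
        refine Finset.sum_congr rfl fun s _ => ?_
        rw [Finset.sum_mul, Finset.mul_sum]
        refine Finset.sum_congr rfl fun t _ => ?_
        ring
    _ ≤ (cD * Real.exp δ * Real.sqrt N) ^ 2 * cC * (((P.L : ℝ) ^ l) ^ P.d)⁻¹ * (P.mesh 0 * ‖w‖) *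
          (profile P N (δ / 2) ^ 2 *
            Real.exp (-(δ / 2 * (HiggsLattice.Site.tdist (blockIter l b.src) (blockIter l c.src) : ℝ)))) :=
        mul_le_mul_of_nonneg_left (sum3_le hδ (blockIter l b.src) (blockIter l c.src) i₀) (by positivity)
    _ ≤ (cD * Real.exp δ * Real.sqrt N) ^ 2 * cC * (((P.L : ℝ) ^ l) ^ P.d)⁻¹ * (P.mesh 0 * ‖w‖) *
          (profile P N (δ / 2) ^ 2 * (Real.exp (δ / 2) *
            Real.exp (-(δ / 2 * ((HiggsLattice.Site.tdist b.src c.src : ℝ) / (P.L : ℝ) ^ l))))) :=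
        mul_le_mul_of_nonneg_left (mul_le_mul_of_nonneg_left (exp_blockIter_le hl hδ.le b.src c.src) (pow_nonneg hK 2))
          (by positivity)
    _ = _ := by ring

end EngineR

/-! ## §2 The pieces on a region: `ε^{−d}Σ_i‖(D^ε_{A,μ}G^η_{(j)}(Ω,A)D^{ε*}_{A,ν})(x,x′)e_i‖`, piece by piece, at interior bonds -/

section PieceBoundsR

variable (C : ChargeData N) (Ω : Finset (HiggsLattice.Site P 0)) (A : HiggsLattice.VecField P 0) (msq : ℝ) {a : ℝ} {k j : ℕ}
  {good : HiggsLattice.Site P 0 → Prop}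

/-- **The twice-differentiated kernel of the region piece `j`** in the column-sum norm:
`ε^{−d}Σ_i‖(D^ε_{A,μ}G^η_{(j)}(Ω,A)D^{ε*}_{A,ν})(x, x′)e_i‖ := ε^{−d}·ε^{−1}·Σ_i‖(D^ε_A G^η_{(j)}(Ω,A)(dip_{⟨x′,ν⟩}e_i))(⟨x,μ⟩)‖` (p40's dipole
realises `ε·D^{ε*}_{A,ν}` at `⟨x′,ν⟩`, `sum_inner_dip`; the region pieces are r14's `pieceR`, the operators are NOT modified).
[cite: Balaban1983Higgs3, (2.6) p.424, (2.10) p.426] -/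
def mixedTermR (a : ℝ) (k j : ℕ) (μ ν : Fin P.d) (x x' : HiggsLattice.Site P 0) : ℝ :=
  (P.mesh 0 ^ P.d)⁻¹ * ((P.mesh 0)⁻¹ *
    ∑ i : Ix N, ‖covDeriv C A (pieceR C Ω A msq a k j (dip C A ⟨x', ν⟩ (onb N i))) ⟨x, μ⟩‖)

/-- `mixedTermR ≥ 0`. [cite: Balaban1983Higgs3, (2.10) p.426] -/
theorem mixedTermR_nonneg (μ ν : Fin P.d) (x x' : HiggsLattice.Site P 0) : 0 ≤ mixedTermR C Ω A msq a k j μ ν x x' :=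
  mul_nonneg (inv_nonneg.mpr (pow_nonneg (P.mesh_pos 0).le _))
    (mul_nonneg (inv_nonneg.mpr (P.mesh_pos 0).le) (Finset.sum_nonneg fun _ _ => norm_nonneg _))

/-- scaling bookkeeping: `ε^{−d}·L^{−jd} = (L^jε)^{−d}`. [cite: Balaban1982Higgs1, (1.19) p.607] -/
private theorem inv_mesh_zero_pow_mul (j : ℕ) :
    (P.mesh 0 ^ P.d)⁻¹ * (((P.L : ℝ) ^ j) ^ P.d)⁻¹ = (P.mesh j ^ P.d)⁻¹ := by
  rw [mesh_eq_pow_mul P j, mul_pow, mul_inv, mul_comm]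

/-- **Region piece `j = 0`** at an interior bond `⟨x,μ⟩`: `ε^{−d}Σ_i‖(D^ε_AG^ε_1(Ω,A)D^{ε*}_A)(x,x′)e_i‖ ≤ 2N·c₀′L·e^{ρ}·ε^{−d}·e^{−ρ|x − x′|/L}` from
the (I.2.25) derivative clause at level `1` on the dipole source (`G^η_{(0)} = G^ε_1(Ω,A)`; source `dip_{⟨x′,ν⟩}e_i`: sup `≤ 2`, support
`{x′, x′ + εe_ν}` at distance `≥ |x − x′| − 1` from `x`; `ε^{−1}·(Lε) = L`). [cite: Balaban1983Higgs3, (2.6) p.424, (2.10) p.426]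
[cite: Balaban1982Higgs1, Prop. 2.1 (2.25) p.610] -/
theorem mixedR_piece_zero_le {c₀' ρ : ℝ} (hc₀' : 0 ≤ c₀') (hρ : 0 ≤ ρ)
    (hDG : ∀ (g : ScalarField P 0 N) (M D : ℝ), (∀ x, ‖g x‖ ≤ M) → 0 ≤ D →
      ∀ b : HiggsLattice.PBond P 0, good b.src → (∀ z, g z ≠ 0 → D ≤ (HiggsLattice.Site.tdist b.src z : ℝ)) →
        ‖covDeriv C A (propagatorK C Ω A msq a 1 g) b‖
          ≤ c₀' * P.mesh 1 * Real.exp (-(ρ * (D / (P.L : ℝ) ^ 1))) * M)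
    (μ ν : Fin P.d) {x : HiggsLattice.Site P 0} (hx : good x) (x' : HiggsLattice.Site P 0) :
    mixedTermR C Ω A msq a k 0 μ ν x x'
      ≤ ((N : ℝ) * 2 * c₀' * (P.L : ℝ) * Real.exp ρ) * (P.mesh 0 ^ P.d)⁻¹ *
          Real.exp (-(ρ * ((HiggsLattice.Site.tdist x x' : ℝ) / (P.L : ℝ) ^ 1))) := by
  set X := Real.exp (-(ρ * ((HiggsLattice.Site.tdist x x' : ℝ) / (P.L : ℝ) ^ 1))) with hX
  set D : ℝ := max 0 ((HiggsLattice.Site.tdist x x' : ℝ) - 1) with hD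
  have hL1 : (1 : ℝ) ≤ P.L := by exact_mod_cast P.hL
  have hm0 : 0 < P.mesh 0 := P.mesh_pos 0
  -- the decay factor at `D ≥ |x − x′| − 1`: `e^{−ρD/L} ≤ e^{ρ}·e^{−ρ|x−x′|/L}`
  have hexp : Real.exp (-(ρ * (D / (P.L : ℝ) ^ 1))) ≤ Real.exp ρ * X := by
    rw [hX, ← Real.exp_add]
    apply Real.exp_le_exp.mpr
    rw [pow_one]
    have hL0 : (0 : ℝ) < P.L := by linarith
    have h1 : (HiggsLattice.Site.tdist x x' : ℝ) - 1 ≤ D := le_max_right _ _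
    have h2 : ρ * (((HiggsLattice.Site.tdist x x' : ℝ) - 1) / P.L) ≤ ρ * (D / P.L) :=
      mul_le_mul_of_nonneg_left (div_le_div_of_nonneg_right h1 hL0.le) hρ
    have h3 : ρ / P.L ≤ ρ := div_le_self hρ hL1
    have h4 : ρ * (((HiggsLattice.Site.tdist x x' : ℝ) - 1) / P.L)
        = ρ * ((HiggsLattice.Site.tdist x x' : ℝ) / P.L) - ρ / P.L := by ring
    linarith
  have h1 : ∀ i : Ix N, ‖covDeriv C A (pieceR C Ω A msq a k 0 (dip C A ⟨x', ν⟩ (onb N i))) ⟨x, μ⟩‖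
      ≤ c₀' * P.mesh 1 * (Real.exp ρ * X) * 2 := by
    intro i
    rw [pieceR_zero]
    have h := hDG (dip C A ⟨x', ν⟩ (onb N i)) 2 D
      (fun y => by have := norm_dip_le (C := C) (A := A) ⟨x', ν⟩ (onb N i) y; rwa [norm_onb, mul_one] at this)
      (le_max_left _ _) ⟨x, μ⟩ hx (fun z hz => dip_support_dist C A ν x x' (onb N i) hz)
    refine h.trans ?_
    exact mul_le_mul_of_nonneg_right (mul_le_mul_of_nonneg_left hexp (mul_nonneg hc₀' (P.mesh_pos 1).le)) (by norm_num)
  have hsum : ∑ i : Ix N, ‖covDeriv C A (pieceR C Ω A msq a k 0 (dip C A ⟨x', ν⟩ (onb N i))) ⟨x, μ⟩‖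
      ≤ N * (c₀' * P.mesh 1 * (Real.exp ρ * X) * 2) := by
    refine (Finset.sum_le_sum fun i _ => h1 i).trans ?_
    rw [Finset.sum_const, card_Ix, nsmul_eq_mul]
  unfold mixedTermR
  refine (mul_le_mul_of_nonneg_left (mul_le_mul_of_nonneg_left hsum (inv_nonneg.mpr hm0.le))
    (inv_nonneg.mpr (pow_nonneg hm0.le _))).trans (le_of_eq ?_)
  rw [mesh_eq_pow_mul P 1, pow_one]
  field_simp

/-- **Region piece `1 ≤ j < k`** at interior bonds `⟨x,μ⟩`, `⟨x′,ν⟩`: `ε^{−d}Σ_i‖(D^ε_AG^η_{(j)}(Ω,A)D^{ε*}_A)(x,x′)e_i‖ ≤ N²a²c₀′²c₁·e^{2δ}e^{δ/2}K(δ/2)²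
· (L^jε)^{−d} · e^{−(δ/2)|x − x′|/L^j}` — the scaling `ε^{−d}·ε^{−1}·a_j²(L^jε)^{−4}·(L^jε)^{1+2+1}·L^{−jd}·ε = a_j²(L^jε)^{−d}` of the print's «rescaling
from the η-lattice to the L^{−j}-lattice», both derivatives on the outer factors `G^ε_j(Ω,A)` (the region engine
`norm_covDeriv_sandwichR_dip_le`). [cite: Balaban1983Higgs3, (2.6) p.424, (2.10) p.426] [cite: Balaban1982Higgs1, (2.43) p.612] -/
theorem mixedR_piece_pos_le (ha : 0 < a) (hL1 : 1 < P.L) (hj1 : 1 ≤ j) (hjk : j < k) (hjK : j ≤ P.K) (hmsq : 0 < msq)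
    (hΩ : ∀ x x' : HiggsLattice.Site P 0, blockIter j x = blockIter j x' → (x ∈ Ω ↔ x' ∈ Ω)) (hgood : ∀ x, good x → x ∈ Ω)
    (hgood' : ∀ (x : HiggsLattice.Site P 0) (μ : Fin P.d), good x → x.shift μ ∈ Ω)
    {c₀' c₁ δ : ℝ} (hc₀' : 0 ≤ c₀') (hc₁ : 0 ≤ c₁) (hδ : 0 < δ)
    (hDG : ∀ (g : ScalarField P 0 N) (M D : ℝ), (∀ x, ‖g x‖ ≤ M) → 0 ≤ D →
      ∀ b : HiggsLattice.PBond P 0, good b.src → (∀ z, g z ≠ 0 → D ≤ (HiggsLattice.Site.tdist b.src z : ℝ)) →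
        ‖covDeriv C A (propagatorK C Ω A msq a j g) b‖
          ≤ c₀' * P.mesh j * Real.exp (-(δ * (D / (P.L : ℝ) ^ j))) * M)
    (hC : ∀ s t : HiggsLattice.Site P j × Ix N, s.1 ∈ levelSet j Ω → t.1 ∈ levelSet j Ω →
      |mat (fluctCovA C Ω A msq a j) s t| ≤ c₁ * P.mesh j ^ 2 * Real.exp (-(δ * (HiggsLattice.Site.tdist s.1 t.1 : ℝ))))
    (μ ν : Fin P.d) {x x' : HiggsLattice.Site P 0} (hx : good x) (hx' : good x') :
    mixedTermR C Ω A msq a k j μ ν x x'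
      ≤ ((N : ℝ) ^ 2 * a ^ 2 * c₀' ^ 2 * c₁ * (Real.exp δ ^ 2 * Real.exp (δ / 2) * profile P N (δ / 2) ^ 2)) *
        (P.mesh j ^ P.d)⁻¹ *
          Real.exp (-(δ / 2 * ((HiggsLattice.Site.tdist x x' : ℝ) / (P.L : ℝ) ^ j))) := by
  set X := Real.exp (-(δ / 2 * ((HiggsLattice.Site.tdist x x' : ℝ) / (P.L : ℝ) ^ j))) with hX
  have hm0 : 0 < P.mesh 0 := P.mesh_pos 0
  have hmj : 0 < P.mesh j := P.mesh_pos j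
  have hLj : (0 : ℝ) < (P.L : ℝ) ^ j := pow_pos (by exact_mod_cast P.hL) j
  have hK : 0 ≤ profile P N (δ / 2) := profile_nonneg' _ (by linarith)
  have hak : 0 ≤ B1.aSeq a P.L j := (B1.aSeq_pos ha (by exact_mod_cast hL1) hj1).le
  have hsw : ∀ i : Ix N, ‖covDeriv C A (pieceR C Ω A msq a k j (dip C A ⟨x', ν⟩ (onb N i))) ⟨x, μ⟩‖
      ≤ coeff221 P a j ^ 2 * ((c₀' * P.mesh j * Real.exp δ * Real.sqrt N) ^ 2 * (c₁ * P.mesh j ^ 2) *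
          (((P.L : ℝ) ^ j) ^ P.d)⁻¹ * profile P N (δ / 2) ^ 2 * Real.exp (δ / 2) * (P.mesh 0 * 1) * X) := by
    intro i
    rw [pieceR_of_pos hj1 hjk, LinearMap.smul_apply, covDeriv_smul'', norm_smul, Real.norm_eq_abs,
      abs_of_nonneg (sq_nonneg _)]
    refine mul_le_mul_of_nonneg_left ?_ (sq_nonneg _)
    have h := norm_covDeriv_sandwichR_dip_le C Ω A msq a hjK hmsq hak hΩ hgood hgood' (by positivity) (by positivity) hδ hDG hC
      (c := ⟨x', ν⟩) hx' (onb N i) (b := ⟨x, μ⟩) hx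
    rw [norm_onb] at h
    exact h
  have hsum : ∑ i : Ix N, ‖covDeriv C A (pieceR C Ω A msq a k j (dip C A ⟨x', ν⟩ (onb N i))) ⟨x, μ⟩‖
      ≤ N * (coeff221 P a j ^ 2 * ((c₀' * P.mesh j * Real.exp δ * Real.sqrt N) ^ 2 * (c₁ * P.mesh j ^ 2) *
          (((P.L : ℝ) ^ j) ^ P.d)⁻¹ * profile P N (δ / 2) ^ 2 * Real.exp (δ / 2) * (P.mesh 0 * 1) * X)) := by
    refine (Finset.sum_le_sum fun i _ => hsw i).trans ?_
    rw [Finset.sum_const, card_Ix, nsmul_eq_mul]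
  unfold mixedTermR
  refine (mul_le_mul_of_nonneg_left (mul_le_mul_of_nonneg_left hsum (inv_nonneg.mpr hm0.le))
    (inv_nonneg.mpr (pow_nonneg hm0.le _))).trans ?_
  have hsq : (c₀' * P.mesh j * Real.exp δ * Real.sqrt N) ^ 2 = (c₀' * P.mesh j * Real.exp δ) ^ 2 * N := by
    rw [mul_pow (c₀' * P.mesh j * Real.exp δ), Real.sq_sqrt (Nat.cast_nonneg _)]
  rw [hsq, B1Eq243HiggsModel.coeff221_sq]
  -- the scaling identity
  have hid : (P.mesh 0 ^ P.d)⁻¹ * ((P.mesh 0)⁻¹ * (N * (B1.aSeq a (P.L : ℝ) j ^ 2 * (P.mesh j ^ 4)⁻¹ *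
        ((c₀' * P.mesh j * Real.exp δ) ^ 2 * N * (c₁ * P.mesh j ^ 2) *
          (((P.L : ℝ) ^ j) ^ P.d)⁻¹ * profile P N (δ / 2) ^ 2 * Real.exp (δ / 2) * (P.mesh 0 * 1) * X))))
      = B1.aSeq a (P.L : ℝ) j ^ 2 * (((N : ℝ) ^ 2 * c₀' ^ 2 * c₁ *
          (Real.exp δ ^ 2 * Real.exp (δ / 2) * profile P N (δ / 2) ^ 2)) * (P.mesh j ^ P.d)⁻¹ * X) := by
    calc (P.mesh 0 ^ P.d)⁻¹ * ((P.mesh 0)⁻¹ * (N * (B1.aSeq a (P.L : ℝ) j ^ 2 * (P.mesh j ^ 4)⁻¹ *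
          ((c₀' * P.mesh j * Real.exp δ) ^ 2 * N * (c₁ * P.mesh j ^ 2) *
            (((P.L : ℝ) ^ j) ^ P.d)⁻¹ * profile P N (δ / 2) ^ 2 * Real.exp (δ / 2) * (P.mesh 0 * 1) * X))))
        = B1.aSeq a (P.L : ℝ) j ^ 2 * (((N : ℝ) ^ 2 * c₀' ^ 2 * c₁ *
            (Real.exp δ ^ 2 * Real.exp (δ / 2) * profile P N (δ / 2) ^ 2)) * X) *
            ((P.mesh 0 ^ P.d)⁻¹ * (((P.L : ℝ) ^ j) ^ P.d)⁻¹) * ((P.mesh j ^ 4)⁻¹ * P.mesh j ^ 4) *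
            ((P.mesh 0)⁻¹ * P.mesh 0) := by ring
      _ = _ := by
        rw [inv_mesh_zero_pow_mul, inv_mul_cancel₀ (pow_ne_zero 4 hmj.ne'), inv_mul_cancel₀ hm0.ne']; ring
  rw [hid]
  have hrest : 0 ≤ ((N : ℝ) ^ 2 * c₀' ^ 2 * c₁ * (Real.exp δ ^ 2 * Real.exp (δ / 2) * profile P N (δ / 2) ^ 2)) *
      (P.mesh j ^ P.d)⁻¹ * X := by positivity
  calc B1.aSeq a (P.L : ℝ) j ^ 2 * (((N : ℝ) ^ 2 * c₀' ^ 2 * c₁ *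
          (Real.exp δ ^ 2 * Real.exp (δ / 2) * profile P N (δ / 2) ^ 2)) * (P.mesh j ^ P.d)⁻¹ * X)
      ≤ a ^ 2 * (((N : ℝ) ^ 2 * c₀' ^ 2 * c₁ *
          (Real.exp δ ^ 2 * Real.exp (δ / 2) * profile P N (δ / 2) ^ 2)) * (P.mesh j ^ P.d)⁻¹ * X) :=
        mul_le_mul_of_nonneg_right (aSeq_sq_le ha hL1 hj1) hrest
    _ = _ := by ring

/-- **Region pieces `j ≥ k`, `j ≥ 1` vanish** (no such terms in (2.6)). [cite: Balaban1983Higgs3, (2.6) p.424] -/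
theorem mixedTermR_eq_zero_of_le (hj1 : 1 ≤ j) (hkj : k ≤ j) (μ ν : Fin P.d) (x x' : HiggsLattice.Site P 0) :
    mixedTermR C Ω A msq a k j μ ν x x' = 0 := by
  unfold mixedTermR
  simp [pieceR_of_le hj1 hkj, covDeriv_zero'']

end PieceBoundsR

/-! ## §3 The theorem: (2.10) twice differentiated, on regions at a regular background, one smallness parameter -/

section MainR

/-- Rate weakening in a decay factor. [folklore] -/
private theorem exp_rate_mono {ρ ρ' s : ℝ} (h : ρ' ≤ ρ) (hs : 0 ≤ s) : Real.exp (-(ρ * s)) ≤ Real.exp (-(ρ' * s)) :=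
  Real.exp_le_exp.mpr (by nlinarith)

/-- weakening in the exponent: `e^{−u} ≤ e^{−v}` when `v ≤ u`. [folklore] -/
private theorem exp_le_exp_of_le {u v : ℝ} (h : v ≤ u) : Real.exp (-u) ≤ Real.exp (-v) :=
  Real.exp_le_exp.mpr (neg_le_neg h)

/-- p35's rate `D/(4K₀L^l)` dominates a common rate `δ ≤ 1/(4K₀)` (as in r14's region member). [folklore] -/
private theorem exp_p35_le {K₀ l : ℕ} (hK₀ : 0 < K₀) {δ D : ℝ} (hδ : δ ≤ 1 / (4 * K₀)) (hD : 0 ≤ D)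
    (hLl : (0 : ℝ) < (P.L : ℝ) ^ l) :
    Real.exp (-(D / (4 * K₀ * (P.L : ℝ) ^ l))) ≤ Real.exp (-(δ * (D / (P.L : ℝ) ^ l))) := by
  apply exp_le_exp_of_le
  have hK : (0 : ℝ) < 4 * K₀ := by positivity
  have h1 : D / (4 * K₀ * (P.L : ℝ) ^ l) = 1 / (4 * K₀) * (D / (P.L : ℝ) ^ l) := by
    field_simp
  rw [h1]
  exact mul_le_mul_of_nonneg_right hδ (by positivity)

/-- **B3 (2.10) p. 426 [PDF 16], THE TWICE-DIFFERENTIATED CLAUSE, PROVED ON A REGION `Ω ⊆ T_η` THAT IS A UNION OF BIG BLOCKS, AT A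
REGULAR NON-CONSTANT BACKGROUND `B̃ = A`, AT INTERIOR POINTS, uniformly in the volume — ONE SMALLNESS PARAMETER.**  For `d ≥ 1`,
`L ≥ 2`, `a, m² > 0`, `N` and EVERY charge `C = (e, U)` there is a threshold `K₀,min` and, for every cube size `K₀ ≥ K₀,min`, constants
`t, δ₁, C > 0` such that: for every volume `P` of the (Higgs)₂,₃ torus family `HiggsLattice.Params` with these `d, L` and `K₀ ∣ M`, every
scale `1 ≤ k ≤ K` with `L^kε ≤ 1` and at least three cubes a side (`3L^kK₀ ≤ |T_ε|_μ`), every region `Ω ⊆ T_ε` that is a union of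
`L^kK₀`-cells (`IsBigBlockUnion k K₀ Ω`; `Ω = T_ε` allowed), every configuration `A` that is `δ_A`-REGULAR ON `Ω`
(`|A(⟨z + e_ν, μ⟩) − A(⟨z, μ⟩)| ≤ δ_A`, `z ∈ Ω`) with the single smallness `L^k·δ_A·|e| ≤ t` (print's *"for e(L^kε) sufficiently small"*,
Proposition I.2.1, in the (I.2.23) currency): for all pieces `j`, all directions `μ, ν` and all INTERIOR points `x, x′` of `Ω`
(`Interior k K₀ Ω`: r14's form of the clause *"dist({x,x′},Ωᶜ) ≥ R₀"* of Proposition I.2.1),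
`ε^{−d}Σ_i‖(D^ε_{A,μ}G^η_{(j)}D^{ε*}_{A,ν})(Ω, A; x, x′)e_i‖ ≤ C(L^jη)^{−d}e^{−δ₁(L^jη)^{−1}|x−x′|}` (`|x − x′| = ε·tdist`).
Print: *"and if the propagator is differentiated, then for each differentiation, there is an additional factor (L^jη)^{−1} on the right
side. … They all are obtained by rescaling from the η-lattice to the L^{−j}-lattice and application of Propositions I.2.1 and I.2.3."*
Route: exactly that, as in p40's torus member — the pieces (2.6) are the terms of (I.2.43) for the region operators (r14's `pieceR`); in each
term `a_j²(L^jε)^{−4}G^ε_j(Ω,A)Q_j^*C^{(j)}(Ω,A)Q_jG^ε_j(Ω,A)` the left derivative falls on the first factor, the right (adjoint) derivative on the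
last one, both bounded through Proposition I.2.1 (2.25) at a regular `A` on big-block regions, derivative member, at the interior bonds
(p35's `B1Ineq225DerivRegularRegion.norm_covDeriv_propagatorK_region_reg_decay_sum`; the last factor after the adjointness
`(Q_jG^ε_j(Ω))^* = G^ε_j(Ω)Q_j^*`, `abs_coord_QG_dip_le_R`, its coordinates outside `Ω^{(j)}` vanishing), the middle one through (I.2.34) on
`Ω^{(j)} × Ω^{(j)}` (p35's one-parameter `B1Prop23RegularRegionSmall.prop23_regular_region_small` on r14's constant tower `towerR Ω k`, read
through `C^{(j)}_{Ω^{(j)}}(Ω,A) = 1_{Ω^{(j)}}C^{(j)}(Ω,A)`, r14's `mat_condCov232_levelSet`), the three-kernel convolution on `T^{(j)}`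
(`sum3_le`); the piece `G^η_{(0)} = G^ε_1(Ω,A)` is (2.25) at level `1` on the dipole.  Honest scope: interior points only (nothing claimed
within the margin of `Ωᶜ`); `m² > 0`; big-block unions with the cube-count hypothesis and `K₀ ∣ M`; constants depend on `K₀` and are chosen
after the charge data (shape of the (I.2.25) input); `|·|` of a block = column sum of Euclidean norms over an orthonormal basis of `ℝ^N`.
[cite: Balaban1983Higgs3, (2.6) p.424, (2.10) p.426] [cite: Balaban1982Higgs1, Prop. 2.1 (2.23), (2.25) p.610, Prop. 2.3 (2.34) p.611, (2.43) p.612] -/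
theorem ineq210_mixed_regularRegion (d L : ℕ) (hd : 1 ≤ d) (hL : 2 ≤ L) {a : ℝ} (ha : 0 < a) {msq : ℝ} (hmsq : 0 < msq)
    (N : ℕ) (C : ChargeData N) :
    ∃ K₀min : ℕ, ∀ K₀ : ℕ, K₀min ≤ K₀ → ∃ t δ₁ Cst : ℝ, 0 < t ∧ 0 < δ₁ ∧ 0 < Cst ∧
      ∀ (P : HiggsLattice.Params), P.d = d → P.L = L → K₀ ∣ P.M →
      ∀ {k : ℕ}, 1 ≤ k → k ≤ P.K → (∀ μ, 3 * half P k K₀ ≤ P.sitesPerDir 0 μ) → P.mesh k ≤ 1 →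
      ∀ (Ω : Finset (HiggsLattice.Site P 0)), IsBigBlockUnion k K₀ Ω →
      ∀ (A : HiggsLattice.VecField P 0) {δA : ℝ}, 0 ≤ δA →
        (∀ z ∈ Ω, ∀ μ ν : Fin P.d, |A ⟨z.shift ν, μ⟩ - A ⟨z, μ⟩| ≤ δA) →
        (P.L : ℝ) ^ k * δA * |C.e| ≤ t →
        ∀ (j : ℕ) (μ ν : Fin P.d) (x x' : HiggsLattice.Site P 0), Interior k K₀ Ω x → Interior k K₀ Ω x' →
          mixedTermR C Ω A msq a k j μ ν x x'
            ≤ Cst * (P.mesh j ^ P.d)⁻¹ * Real.exp (-(δ₁ * ((HiggsLattice.Site.tdist x x' : ℝ) / (P.L : ℝ) ^ j))) := by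
  have hL1 : 1 < L := by omega
  obtain ⟨t₀, c₁, ρ₃, ht₀, hc₁, hρ₃, hCov⟩ := B1Prop23RegularRegionSmall.prop23_regular_region_small d L hL1 ha hmsq N
  obtain ⟨K₂, hD⟩ :=
    B1Ineq225DerivRegularRegion.norm_covDeriv_propagatorK_region_reg_decay_sum d L hd hL ha hmsq N C 1 1 1 zero_le_one one_pos
  refine ⟨max K₂ 1, fun K₀ hK₀ => ?_⟩
  have hK₂ : K₂ ≤ K₀ := (le_max_left _ _).trans hK₀
  have hK₀1 : 1 ≤ K₀ := (le_max_right _ _).trans hK₀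
  obtain ⟨c₀', e₂, hc₀', he₂, hD⟩ := hD K₀ hK₂
  -- the common rate, the smallness threshold and the constant
  obtain ⟨δ, hδ⟩ : ∃ δ : ℝ, δ = min (1 / (4 * (K₀ : ℝ))) ρ₃ := ⟨_, rfl⟩
  have hδpos : 0 < δ := by rw [hδ]; exact lt_min (by positivity) hρ₃
  have hδ₁ : δ ≤ 1 / (4 * K₀) := by rw [hδ]; exact min_le_left _ _
  have hδ₃ : δ ≤ ρ₃ := by rw [hδ]; exact min_le_right _ _
  have hLpos : (0 : ℝ) < L := by exact_mod_cast (by omega : 0 < L)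
  refine ⟨min e₂ t₀, δ / (2 * L), cstMix d L N a c₀' c₁ δ, lt_min he₂ ht₀, div_pos hδpos (by positivity),
    cstMix_pos hc₀'.le hc₁.le, ?_⟩
  intro P hPd hPL hK₀M k hk1 hkK h3 hmesh Ω hΩ A δA hδA hreg ht j μ ν x x' hx hx'
  subst hPd hPL
  have hL1' : 1 < P.L := hL1
  have hLr : 1 < (P.L : ℝ) := by exact_mod_cast hL1'
  have hLge1 : (1 : ℝ) ≤ P.L := hLr.le
  have hCst : 0 ≤ cstMix P.d P.L N a c₀' c₁ δ := (cstMix_pos hc₀'.le hc₁.le).le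
  have hte₂ : (P.L : ℝ) ^ k * δA * |C.e| ≤ e₂ := ht.trans (min_le_left _ _)
  have htt₀ : (P.L : ℝ) ^ k * δA * |C.e| ≤ t₀ := ht.trans (min_le_right _ _)
  -- block-union facts at every level `l ≤ k`
  have hΩl : ∀ {l : ℕ}, l ≤ k → ∀ x x' : HiggsLattice.Site P 0, blockIter l x = blockIter l x' → (x ∈ Ω ↔ x' ∈ Ω) :=
    fun hl => blockUnion_of_isBigBlockUnion hl hΩ
  -- (I.2.25) derivative at level `l`, engine form, at interior bonds
  have hDl : ∀ {l : ℕ}, 1 ≤ l → l ≤ k → ∀ (g : ScalarField P 0 N) (M D : ℝ), (∀ x, ‖g x‖ ≤ M) → 0 ≤ D →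
      ∀ b : HiggsLattice.PBond P 0, Interior k K₀ Ω b.src → (∀ z, g z ≠ 0 → D ≤ (HiggsLattice.Site.tdist b.src z : ℝ)) →
        ‖covDeriv C A (propagatorK C Ω A msq a l g) b‖
          ≤ c₀' * P.mesh l * Real.exp (-(δ * (D / (P.L : ℝ) ^ l))) * M := by
    intro l hl1 hlk g M D hg hD0 b hb hsupp
    have hmesh_l : P.mesh l ≤ 1 := (mesh_mono P hlk).trans hmesh
    have h3l : ∀ μ, 3 * half P l K₀ ≤ P.sitesPerDir 0 μ := fun μ => (Nat.mul_le_mul_left _ (half_mono hlk)).trans (h3 μ)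
    have hak : 0 ≤ B1.aSeq a P.L l := (B1.aSeq_pos ha hLr hl1).le
    have h := hD P rfl rfl hK₀M hl1 (hlk.trans hkK) h3l hmesh_l Ω (isBigBlockUnion_of_le hlk hΩ) A he₂ le_rfl
      (reg223R_of_small C Ω A hlk hmesh_l he₂ hδA hreg hte₂ le_rfl) b.src b.dir (hb.margin' hlk) g M D hg hD0 hsupp
    -- `G(1_Ωg)` and `Gg` agree on `Ω ∋ b₋, b₊`
    have hcut : ∀ y ∈ Ω, propagatorK C Ω A msq a l (chi Ω • g) y = propagatorK C Ω A msq a l g y :=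
      fun y hy => (propagatorK_apply_eq_chi C A hmsq hak (hΩl hlk) g hy).symm
    have hbb : (⟨b.src, b.dir⟩ : HiggsLattice.PBond P 0) = b := rfl
    rw [hbb] at h
    have hb' : covDeriv C A (propagatorK C Ω A msq a l (chi Ω • g)) b
        = covDeriv C A (propagatorK C Ω A msq a l g) b := by
      have h1 : propagatorK C Ω A msq a l (chi Ω • g) b.tgt = propagatorK C Ω A msq a l g b.tgt :=
        hcut _ (hb.shift_mem b.dir)
      have h2 : propagatorK C Ω A msq a l (chi Ω • g) b.src = propagatorK C Ω A msq a l g b.src := hcut _ hb.mem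
      rw [B1Cor23RegularRegion.covDeriv_eq, B1Cor23RegularRegion.covDeriv_eq, h1, h2]
    rw [hb'] at h
    refine h.trans ?_
    have hM : 0 ≤ M := (norm_nonneg _).trans (hg b.src)
    have hml : 0 < P.mesh l := P.mesh_pos l
    have hLl : (0 : ℝ) < (P.L : ℝ) ^ l := pow_pos (by exact_mod_cast P.hL) l
    have hexp := exp_p35_le (P := P) (by omega : 0 < K₀) hδ₁ hD0 hLl
    exact mul_le_mul_of_nonneg_right (mul_le_mul_of_nonneg_left hexp (by positivity)) hM
  -- (I.2.34) at level `l < k` on `Ω^{(l)} × Ω^{(l)}`, one smallness parameter (p35's `prop23_regular_region_small`)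
  have hCl : ∀ {l : ℕ}, 1 ≤ l → l < k → ∀ s t : HiggsLattice.Site P l × Ix N, s.1 ∈ levelSet l Ω → t.1 ∈ levelSet l Ω →
      |mat (fluctCovA C Ω A msq a l) s t| ≤ c₁ * P.mesh l ^ 2 * Real.exp (-(δ * (HiggsLattice.Site.tdist s.1 t.1 : ℝ))) := by
    intro l hl1 hlk s t hs ht'
    obtain ⟨j, rfl⟩ : ∃ j, l = j + 1 := ⟨l - 1, by omega⟩
    have hmesh_l : P.mesh (j + 1) ≤ 1 := (mesh_mono P hlk.le).trans hmesh
    have hjK : j + 1 < P.K := lt_of_lt_of_le hlk hkK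
    have htl : (P.L : ℝ) ^ (j + 1) * δA * |C.e| ≤ t₀ := by
      have hpow : (P.L : ℝ) ^ (j + 1) ≤ (P.L : ℝ) ^ k := pow_le_pow_right₀ hLge1 hlk.le
      have h0 : 0 ≤ δA * |C.e| := by positivity
      calc (P.L : ℝ) ^ (j + 1) * δA * |C.e| = (P.L : ℝ) ^ (j + 1) * (δA * |C.e|) := by ring
        _ ≤ (P.L : ℝ) ^ k * (δA * |C.e|) := mul_le_mul_of_nonneg_right hpow h0
        _ = (P.L : ℝ) ^ k * δA * |C.e| := by ring
        _ ≤ t₀ := htt₀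
    -- the constant tower of height `k`, index `j`
    have hjk : j < k := by omega
    have hpf : pieceF (towerR Ω k) ⟨j, hjk⟩ = Ω := pieceF_towerR ⟨j, hjk⟩ (hΩl hlk.le)
    have hregF : ∀ z ∈ pieceF (towerR Ω k) ⟨j, hjk⟩, ∀ μ' ν : Fin P.d, |A ⟨z.shift ν, μ'⟩ - A ⟨z, μ'⟩| ≤ δA := by
      rw [hpf]; exact hreg
    have hj2 : j + 2 ≤ k := by omega
    have hΛ := levelSet_blockUnion hjK.le (hΩl hlk.le) (hΩl hj2)
    have h := (hCov C P rfl rfl (towerR Ω k) hkK ⟨j, hjk⟩ hjK hmesh_l hΛ A hδA hregF htl (Λ := levelSet (j + 1) Ω)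
      (subset_refl _) hs ht').1
    rw [hpf, mat_condCov232_levelSet C A hjK.le hmsq ha hLr (hΩl hlk.le) (hΩl hj2) hs] at h
    refine h.trans ?_
    have hexp : Real.exp (-(ρ₃ * (HiggsLattice.Site.tdist s.1 t.1 : ℝ))) ≤ Real.exp (-(δ * (HiggsLattice.Site.tdist s.1 t.1 : ℝ))) :=
      exp_le_exp_of_le (mul_le_mul_of_nonneg_right hδ₃ (Nat.cast_nonneg _))
    calc P.mesh (j + 1) ^ 2 * c₁ * Real.exp (-(ρ₃ * (HiggsLattice.Site.tdist s.1 t.1 : ℝ)))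
        ≤ P.mesh (j + 1) ^ 2 * c₁ * Real.exp (-(δ * (HiggsLattice.Site.tdist s.1 t.1 : ℝ))) :=
          mul_le_mul_of_nonneg_left hexp (by positivity)
      _ = _ := by ring
  -- rate bookkeeping: `δ/(2L) ≤ δ/2` and the `j = 0` exponent (rate `δ` at level `1` beats rate `δ/(2L)` at level `0`)
  have hrate : δ / (2 * P.L) ≤ δ / 2 := by
    rw [div_le_div_iff₀ (by positivity) (by norm_num : (0 : ℝ) < 2)]
    nlinarith
  have hexp0 : Real.exp (-(δ * ((HiggsLattice.Site.tdist x x' : ℝ) / (P.L : ℝ) ^ 1)))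
      ≤ Real.exp (-(δ / (2 * P.L) * ((HiggsLattice.Site.tdist x x' : ℝ) / (P.L : ℝ) ^ 0))) := by
    apply exp_le_exp_of_le
    rw [pow_one, pow_zero, div_one]
    have h0 : 0 ≤ δ * ((HiggsLattice.Site.tdist x x' : ℝ) / P.L) := by positivity
    calc δ / (2 * P.L) * (HiggsLattice.Site.tdist x x' : ℝ) = (1 / 2) * (δ * ((HiggsLattice.Site.tdist x x' : ℝ) / P.L)) := by
          ring
      _ ≤ δ * ((HiggsLattice.Site.tdist x x' : ℝ) / P.L) := by linarith
  have hexpj : Real.exp (-(δ / 2 * ((HiggsLattice.Site.tdist x x' : ℝ) / (P.L : ℝ) ^ j)))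
      ≤ Real.exp (-(δ / (2 * P.L) * ((HiggsLattice.Site.tdist x x' : ℝ) / (P.L : ℝ) ^ j))) :=
    exp_rate_mono hrate (by positivity)
  have hgood : ∀ x, Interior k K₀ Ω x → x ∈ Ω := fun x hx => hx.mem
  have hgood' : ∀ (x : HiggsLattice.Site P 0) (μ : Fin P.d), Interior k K₀ Ω x → x.shift μ ∈ Ω := fun x μ hx => hx.shift_mem μ
  have hmj : 0 < P.mesh j := P.mesh_pos j
  rcases Nat.eq_zero_or_pos j with rfl | hj1
  · -- the piece `G^η_{(0)} = G^ε_1(Ω,A)`: (I.2.25) at level `1` on the dipole source, interior bond at `x`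
    refine (mixedR_piece_zero_le C Ω A msq (k := k) hc₀'.le hδpos.le (hDl le_rfl hk1) μ ν hx x').trans ?_
    rw [pow_zero] at hexp0 ⊢
    exact mul_le_mul (mul_le_mul_of_nonneg_right (le_cstMix_zero hc₀'.le hc₁.le) (by positivity)) hexp0
      (Real.exp_pos _).le (by positivity)
  · by_cases hjk : j < k
    · refine (mixedR_piece_pos_le C Ω A msq ha hL1' hj1 hjk (hjk.le.trans hkK) hmsq (hΩl hjk.le) hgood hgood' hc₀'.le hc₁.le
        hδpos (hDl hj1 hjk.le) (hCl hj1 hjk) μ ν hx hx').trans ?_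
      exact mul_le_mul (mul_le_mul_of_nonneg_right (le_cstMix_pos hc₀'.le hc₁.le) (by positivity)) hexpj
        (Real.exp_pos _).le (by positivity)
    · rw [mixedTermR_eq_zero_of_le C Ω A msq hj1 (not_lt.mp hjk)]
      positivity

end MainR

/-! ## §4 The full torus as a region: p40's torus quantity for EVERY `L ≥ 2` -/

section UnivR

variable (C : ChargeData N) (A : HiggsLattice.VecField P 0) (msq a : ℝ)

/-- **The region pieces of the full torus ARE the torus pieces**: `pieceR C T_ε A = pieceA C A` (r14's two definitions agree on
`Ω = T_ε` by unfolding: (2.6) = the terms of (I.2.43) with `G^ε_j(T_ε, A)`, `C^{(j)}(T_ε, A)`). [cite: Balaban1983Higgs3, (2.6) p.424] -/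
theorem pieceR_univ (k j : ℕ) :
    pieceR C Finset.univ A msq a k j = B3Ineq210RegularTorus.pieceA C A msq a k j := by
  unfold pieceR B3Ineq210RegularTorus.pieceA B3Ineq210RegularTorus.termA sandwichR B3Ineq210RegularTorus.sandwich
  rfl

/-- **On the full torus the twice-differentiated region kernel IS p40's torus kernel** `mixedTerm` (same dipole, same pieces).
[cite: Balaban1983Higgs3, (2.6) p.424, (2.10) p.426] -/
theorem mixedTermR_univ (k j : ℕ) (μ ν : Fin P.d) (x x' : HiggsLattice.Site P 0) :
    mixedTermR C Finset.univ A msq a k j μ ν x x' = B3Ineq210MixedRegularTorus.mixedTerm C A msq a k j μ ν x x' := by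
  unfold mixedTermR B3Ineq210MixedRegularTorus.mixedTerm
  simp_rw [pieceR_univ]

/-- **B3 (2.10), the twice-differentiated clause, on the FULL torus `Ω = T_ε` at a regular non-constant background, for EVERY `L ≥ 2`**
(no parity hypothesis; every volume of `HiggsLattice.Params` with `K₀ ∣ M` and at least three cubes a side): the case `Ω = univ` of
`ineq210_mixed_regularRegion` (`IsBigBlockUnion` holds for the whole torus, every point is interior), stated for p40's torus kernel
`B3Ineq210MixedRegularTorus.mixedTerm` through `mixedTermR_univ` — it extends p40's `ineq210_mixed_regularTorus` (the `Shape` sub-family,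
`L` odd) to every `L ≥ 2` with the same single smallness condition `L^k·δ_A·|e| ≤ t`.
[cite: Balaban1983Higgs3, (2.10) p.426] [cite: Balaban1982Higgs1, Prop. 2.1 (2.23), (2.25) p.610, Prop. 2.3 (2.34) p.611] -/
theorem ineq210_mixed_regularRegion_univ (d L : ℕ) (hd : 1 ≤ d) (hL : 2 ≤ L) {a : ℝ} (ha : 0 < a) {msq : ℝ} (hmsq : 0 < msq)
    (N : ℕ) (C : ChargeData N) :
    ∃ K₀min : ℕ, ∀ K₀ : ℕ, K₀min ≤ K₀ → ∃ t δ₁ Cst : ℝ, 0 < t ∧ 0 < δ₁ ∧ 0 < Cst ∧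
      ∀ (P : HiggsLattice.Params), P.d = d → P.L = L → K₀ ∣ P.M →
      ∀ {k : ℕ}, 1 ≤ k → k ≤ P.K → (∀ μ, 3 * half P k K₀ ≤ P.sitesPerDir 0 μ) → P.mesh k ≤ 1 →
      ∀ (A : HiggsLattice.VecField P 0) {δA : ℝ}, 0 ≤ δA →
        (∀ (z : HiggsLattice.Site P 0) (μ ν : Fin P.d), |A ⟨z.shift ν, μ⟩ - A ⟨z, μ⟩| ≤ δA) →
        (P.L : ℝ) ^ k * δA * |C.e| ≤ t →
        ∀ (j : ℕ) (μ ν : Fin P.d) (x x' : HiggsLattice.Site P 0),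
          B3Ineq210MixedRegularTorus.mixedTerm C A msq a k j μ ν x x'
            ≤ Cst * (P.mesh j ^ P.d)⁻¹ * Real.exp (-(δ₁ * ((HiggsLattice.Site.tdist x x' : ℝ) / (P.L : ℝ) ^ j))) := by
  obtain ⟨K₀min, h⟩ := ineq210_mixed_regularRegion d L hd hL ha hmsq N C
  refine ⟨K₀min, fun K₀ hK₀ => ?_⟩
  obtain ⟨t, δ₁, Cst, ht, hδ₁, hCst, h⟩ := h K₀ hK₀
  refine ⟨t, δ₁, Cst, ht, hδ₁, hCst, ?_⟩
  intro P hPd hPL hK₀M k hk1 hkK h3 hmesh A δA hδA hreg ht' j μ ν x x'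
  rw [← mixedTermR_univ]
  exact h P hPd hPL hK₀M hk1 hkK h3 hmesh Finset.univ isBigBlockUnion_univ A hδA (fun z _ μ ν => hreg z μ ν) ht' j μ ν x x'
    (interior_univ x) (interior_univ x')

end UnivR

end Literature.MathematicalPhysics.QuantumFieldTheory.Balaban1983to89.B3Ineq210MixedRegularRegion

end
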